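import Mathlib

set_option linter.dupNamespace false

/-!
# STUB-IDEAS k3 (gen 47) — sketch: digit models + generic glue (0 `sorry`)

crux `stmt-BirchSwinnertonDyer-27851` (`…Theses.PrintCf2.SplitBadTwoLowerHalfOfFacts`), stub `stub_heegnerIndexLowerAtTwo`.
**BSD is NOT proved by any of this; neither the crux nor the stub is proved here.**  `Cruxes/` modules are not importable
on the farm, hence `import Mathlib` and digit models (same convention as the k3-g45 / k3-g46 sketches).

* §1 the family-3 candidate «twin restriction of scalars» in 2-adic digits — its glue is three `omega` lines, which is the
  formal content of the verdict «= the (TF) currency of record, no progress» (autopsy, decision record);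
* §2 good-ification residues (which auxiliary twists `β` make `W^{(β)}` good at `2`; the twist field is always ramified at `2`);
* §3 Hsieh, Doc. Math. 19 (2014) = arXiv:1112.1580 READ AT RESIDUE CHARACTERISTIC 2: the split ε-digit (Lemma 3.4/Prop 3.5),
  the `C′`-digit (Thm 3.18), Frobenius inversion replacing «p > 2» in Lemma 5.4, the order argument Hsieh uses and its
  failure witness at `p = 2`, and the ultrametric stabilisation glue behind every «uniform in n» local constant.
-/

namespace Summit.BirchSwinnertonDyer.BirchSwinnertonDyer.Cruxes.SplitBadTwoLowerHalfOfFacts.TwinResHsiehTwoK3G47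

/-! ## §1 Twin restriction-of-scalars cut (digit model; AUTOPSY — equals the (TF) currency p643613) -/

/-- 2-adic digits `aX = ord₂ Ш_an(X)`, `bX = ord₂ #Ш(X)[2^∞]` for `X ∈ {W/ℚ, A/ℚ, A/F}`, where `A = W^{(β)}` is a quadratic
twist GOOD at `2`, `F = ℚ(√β)`, and `A/F` is the restriction-of-scalars partner: `L(A/F,s) = L(A,s)·L(W,s)`. -/
structure TwinResDigits where
  aW : ℤ
  bW : ℤ
  aA : ℤ
  bA : ℤ
  aF : ℤ
  bF : ℤ

/-- Milne 1972 (invariance of the BSD quotient under restriction of scalars; tree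
`Milne1972.bsdQuotient_baseChange_quadratic_anyModel`) + isogeny invariance (`WeierstrassCurve.bsdRHS_eq_of_isIsogenous`),
after matching periods / regulators / Tamagawa / torsion EXACTLY: both Ш-digits are additive. -/
def MilneAdditive (D : TwinResDigits) : Prop :=
  D.aF = D.aW + D.aA ∧ D.bF = D.bW + D.bA

/-- Regime `r_an(A) = 0`: full BSD for the rank-0 CM twin (bundle conjunct `bsdTriple_of_hasCM_of_L_one_ne_zero`) gives
`aA = bA`, hence LOWER₂(W) ⟺ LOWER₂(A/F).  With `β = d`, `A = X₀(49)` this is the (TF) currency of record verbatim. -/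
theorem lowerW_iff_lowerF_of_rankZeroTwin (D : TwinResDigits) (hM : MilneAdditive D) (hA : D.aA = D.bA) :
    D.aW ≤ D.bW ↔ D.aF ≤ D.bF := by
  obtain ⟨h1, h2⟩ := hM
  constructor <;> intro h <;> omega

/-- The defect is transported exactly: `defect(W) = defect(A/F) − defect(A)`; nothing is gained or lost. -/
theorem defect_transport (D : TwinResDigits) (hM : MilneAdditive D) :
    D.aW - D.bW = (D.aF - D.bF) - (D.aA - D.bA) := by
  obtain ⟨h1, h2⟩ := hM
  omega

/-- Regime `r_an(A) = 1` (twin not chosen of rank 0): LOWER₂(W) would need UPPER₂(A) and LOWER₂(A/F) — circular on the class,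
which is why the auxiliary twist must be a RANK-0 twist (Bump–Friedberg–Hoffstein / Waldspurger supply one). -/
theorem lowerW_of_upperA_of_lowerF (D : TwinResDigits) (hM : MilneAdditive D) (hUpA : D.bA ≤ D.aA)
    (hLowF : D.aF ≤ D.bF) : D.aW ≤ D.bW := by
  obtain ⟨h1, h2⟩ := hM
  omega

/-! ## §2 Good-ification residues -/

/-- Odd keys `d ≡ 3 (mod 4)` (dyadic keys (1,3), (1,7)): for odd `β`, `49a^{(dβ/g²)}` (`g = gcd(d,β)` odd, `g² ≡ 1 (mod 8)`)
is good at `2` iff `dβ ≡ 1 (mod 4)` iff `β ≡ 3 (mod 4)` — so the twist field `ℚ(√β)` is ramified at `2`. -/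
theorem good_twist_residue_odd (d β : ℤ) (hd : d % 4 = 3) :
    (d * β) % 4 = 1 ↔ β % 4 = 3 := by
  rw [Int.mul_emod, hd]
  omega

/-- Even keys `d = 2m`, `m` odd (dyadic keys (0,1),(0,3),(0,5),(0,7)): with `β = 2β'` the twist is `49a^{(mβ'/g²)}`, good at `2`
iff `mβ' ≡ 1 (mod 4)` iff `β' ≡ m (mod 4)`; again `ℚ(√(2β'))` is ramified at `2`. -/
theorem good_twist_residue_even (m β' : ℤ) (hm : m % 2 = 1) :
    (m * β') % 4 = 1 ↔ β' % 4 = m % 4 := by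
  rw [Int.mul_emod]
  have h : m % 4 = 1 ∨ m % 4 = 3 := by omega
  rcases h with h | h <;> rw [h] <;> omega

/-! ## §3 Hsieh 2014 read at residue characteristic 2 (digits and glue) -/

/-- ε-DIGIT AT THE SPLIT PLACE 2 (Lemma 3.4 / Prop 3.5 carry no parity hypothesis on the residue characteristic):
`π₂ = π(μ₁, μ₂)` an unramified principal series (the good twin at `2`), `χ_w` of conductor `2^c`, `c ≥ 1`; Gauss digit
`vG = c/2` (`ℚ₂(ζ_{2^∞})` has ONE prime above `2` and `G·Ḡ = 2^c`), central character of finite order (`v₁ + v₂ = 0`, where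
`vᵢ = ord₂ μᵢ(2)` — individually `∓½` in the ordinary case).  Then `ord₂ ε(½, π₂ ⊗ χ_w, ψ) = c(v₁+v₂) + 2vG − c = 0`,
UNIFORMLY in the conductor exponent `c`. -/
theorem epsilon_digit_split_two (c : ℕ) (v₁ v₂ vG : ℚ) (hcent : v₁ + v₂ = 0) (hG : 2 * vG = c) :
    (c : ℚ) * (v₁ + v₂) + 2 * vG - c = 0 := by
  rw [hcent, hG]
  ring

/-- `C′`-DIGIT: Thm 3.18's constant `C′(π,χ) = 2^{#A(χ)+3[F:ℚ]} · (p-units)` is «a unit as p > 2» (arXiv:1112.1580 p.17 l.5);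
at `p = 2`, `F = ℚ` it is the EXPLICIT digit `#A(χ) + 3`, independent of the conductor exponent. -/
theorem cPrime_digit_two (nA : ℕ) : padicValNat 2 (2 ^ (nA + 3)) = nA + 3 := by
  simp

/-- FROBENIUS INVERSION (replaces «p > 2» in Lemma 5.4, p.23 l.31, at the places RAMIFIED in `K/F`): in the anticyclotomic
Galois group `Γ⁻` (written additively; torsion-free, so `2•x = 0 → x = 0`) a prime `𝔳 = 𝔳̄` has
`Frob_𝔳 = c∘Frob_𝔳∘c⁻¹ = −Frob_𝔳`, hence `Frob_𝔳 = 0`: ramified primes split completely in `K⁻_∞` and `φ_𝔳 = 1` for EVERY `p`,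
including `p = 2`. -/
theorem eq_zero_of_neg_eq_self {Γ : Type*} [AddCommGroup Γ] (h2 : ∀ x : Γ, 2 • x = 0 → x = 0) {x : Γ}
    (hx : -x = x) : x = 0 := by
  apply h2
  rw [two_nsmul]
  calc x + x = -x + x := by rw [hx]
    _ = 0 := neg_add_cancel x

/-- The argument Hsieh actually uses (valid for odd `p` only): an element killed by `2` and by `p^k` is trivial. -/
theorem eq_one_of_sq_eq_one_of_pow_prime_pow_eq_one {G : Type*} [Group G] {g : G} {p k : ℕ} (hp : p.Prime)
    (hodd : p ≠ 2) (hsq : g ^ 2 = 1) (hpk : g ^ p ^ k = 1) : g = 1 := by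
  have hcop : Nat.Coprime 2 (p ^ k) := by
    apply Nat.Coprime.pow_right
    exact (Nat.coprime_primes Nat.prime_two hp).mpr (Ne.symm hodd)
  have h1 : orderOf g ∣ 2 := orderOf_dvd_of_pow_eq_one hsq
  have h2 : orderOf g ∣ p ^ k := orderOf_dvd_of_pow_eq_one hpk
  have h3 : orderOf g ∣ Nat.gcd 2 (p ^ k) := Nat.dvd_gcd h1 h2
  rw [hcop.gcd_eq_one, Nat.dvd_one] at h3
  exact orderOf_eq_one_iff.mp h3

/-- … and its failure witness at `p = 2`: in `ℤ/2` (a quotient of any non-trivial pro-2 group) the class of `1` equals its own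
negative and is non-zero — so at `p = 2` it is torsion-freeness of `Γ⁻` (Frobenius inversion), not the order argument,
that gives `φ_𝔳 = 1`. -/
example : (-(1 : ZMod 2) = 1) ∧ (1 : ZMod 2) ≠ 0 := by decide

/-- ULTRAMETRIC STABILISATION (the glue behind every «uniform in n» local constant, e.g. the unramified-side Euler factors
`(1 − γ·χ_n(ϖ̄)·2^{-1/2})` of the Coates multiplier `E_{Σ₂}` along `χ_n → χ_∞`): a sequence converging to a NON-ZERO
limit in an ultrametric field has eventually constant norm.  The exceptional-zero case (limit `0`) is exactly where
uniformity can fail and must be booked separately. -/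
theorem norm_eventually_eq_of_tendsto {K : Type*} [NormedField K] [IsUltrametricDist K] {u : ℕ → K} {a : K}
    (ha : a ≠ 0) (h : Filter.Tendsto u Filter.atTop (nhds a)) :
    ∀ᶠ n in Filter.atTop, ‖u n‖ = ‖a‖ := by
  have hpos : 0 < ‖a‖ := norm_pos_iff.mpr ha
  have hlt : ∀ᶠ n in Filter.atTop, ‖u n - a‖ < ‖a‖ :=
    (tendsto_iff_norm_sub_tendsto_zero.mp h).eventually (gt_mem_nhds hpos)
  filter_upwards [hlt] with n hn
  have hne : ‖u n - a‖ ≠ ‖a‖ := ne_of_lt hn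
  calc ‖u n‖ = ‖(u n - a) + a‖ := by rw [sub_add_cancel]
    _ = max ‖u n - a‖ ‖a‖ := IsUltrametricDist.norm_add_eq_max_of_norm_ne_norm hne
    _ = ‖a‖ := max_eq_right hn.le

/-- Corollary in the shape a «uniform constant» stub consumes: bounded numerators over denominators tending to a non-zero
limit give an eventually uniform bound. -/
theorem eventually_norm_div_le {K : Type*} [NormedField K] [IsUltrametricDist K] {num den : ℕ → K} {d : K} {C : ℝ}
    (hd : d ≠ 0) (hden : Filter.Tendsto den Filter.atTop (nhds d)) (hnum : ∀ n, ‖num n‖ ≤ C) :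
    ∀ᶠ n in Filter.atTop, ‖num n / den n‖ ≤ C / ‖d‖ := by
  filter_upwards [norm_eventually_eq_of_tendsto hd hden] with n hn
  rw [norm_div, hn]
  gcongr
  exact hnum n

end Summit.BirchSwinnertonDyer.BirchSwinnertonDyer.Cruxes.SplitBadTwoLowerHalfOfFacts.TwinResHsiehTwoK3G47
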